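import Summits.CriticalPhenomena.PercolationContinuityZ3.Theorems.PercNearOneGluingNoHeavyQuantSubproductMixture
import HarnessLib

/-!
# QUANT lane R8, T-DEC: THE GENERAL CYCLIC BOOST CERTIFICATE — three siblings with ARBITRARY root gates, ARBITRARY opened means and
# ARBITRARY (different) sub-trees satisfy the sibling step at the TRUE floor, GIVEN the oracle, as soon as the gates are CYCLICALLY LEGAL:
# `q_{c+1}·m_{c+1} + q_c·m_c ≤ m_{c+1}` (indices mod 3) — the exact reach of the boosted dictionary at width 3

builds on p205010 (kernel theorem, internal audit signed; external expert review pending)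

Support file (`--supports stmt-CriticalPhenomena-4575`), QUANT lane seat prim-quant-census-1 (gen 27), rung R8 of
`run/shared/lean/prim/quant/LADDER.md`; memo `run/shared/lean/prim/quant/prim-quant-census-1/g27/CYCLIC-GENERAL-G27.md`.  Theorems only, standard
axioms, no sorries.  An INSTANCE of ✓ `…QuantSubproductMixture` (`sdec_flaw_of_subproductMix`, p503068).  It strictly contains census-1 g26's
✓ `…QuantCyclicBoostTriple` (`sdec_flaw_cyclicTriple_of_oracle`, p507376: common opened mean AND common floor, pairwise gate sums `≤ 1`) and hence
arm-1 g53's symmetric triple (✓ p503171): with equal means cyclic legality IS `q_c + q_{c+1} ≤ 1` for all `c`.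

THE CERTIFICATE.  Siblings `0,1,2` with gates `q_c ∈ (0,1)`, opened means `m_c > 0`, opened floors `x₁_c`; indices mod 3; boost ratios
`r_c = q_c m_c / m_{c+1}` (the openness that carries sibling `c`'s gated mass when put on sibling `c+1`).  Seven components:
* `Q_c`: DROP sibling `c`, BOOST sibling `c+1` to openness `q_{c+1} + r_c` (sibling `c+2` keeps `q_{c+2}`) — gated mean EXACTLY `fmean = Σ q_i m_i`;
* `O_c`: the PAIR `{c+1, c+2}` fully opened (mean `m_{c+1} + m_{c+2} ≥ fmean` by legality at `c`);  `O₃`: the open triple, weight `q₀q₁q₂`.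
The weights solve the cyclic two-term singleton system `α_a u_{a−1} + β_a u_{a+1} = γ_a` with `α_a = (q_a + r_{a−1})(1−q_{a+1})`,
`β_a = q_a(1 − q_{a−1} − r_{a+1})`, `γ_a = q_a(1−q_{a+1})(1−q_{a−1})`; `Δ = Π_a β_a + Π_a α_a`, and (Cramer, then regrouped into SUMS of products)
    `u_c·Δ = q_{c+1}(1−q_c)(1−q_{c+1})·[q_c r_{c+1} r_{c+2} + q_c q_{c+2}(1−q_c)(1−q_{c+2}−r_{c+1}) + r_{c+2}(q_{c+2}+r_{c+1})(1−q_{c+2})(1−q_c)]`,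
    `w_c·Δ = q_c q_{c+1} q_{c+2}(1−q_c)(1−q_c−r_{c+2})·[q_{c+1}q_{c+2}(1−q_{c+2}−r_{c+1})(1−q_{c+1}−r_c) + r_{c+1}(q_{c+1}+r_c)(1−q_{c+1})]`
(in `w_c·Δ` the product `Π α` cancels exactly against `(q_{c+1}+r_c)(1−q_{c+1})·u_c·Δ`'s leading term).  Every bracket is MANIFESTLY nonnegative under
CYCLIC LEGALITY `q_{c+1} + r_c ≤ 1` (c = 0,1,2), i.e. `q_{c+1} m_{c+1} + q_c m_c ≤ m_{c+1}` — which is exactly the condition that the three boosted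
opennesses are `≤ 1`; nothing else is needed (`Δ ≥ Π α > 0`).  PATTERN IDENTITY (`cyclicTripleGen_pattern`, six free real parameters
`q₀,q₁,q₂,r₀,r₁,r₂`): `Σ_k N_k·P_k(A) = Δ·Π_{i∈A} qᵢ Π_{i∉A}(1−qᵢ)` on the seven non-empty patterns.  MEANS: `Q_c` has `(q_{c+1}+r_c)m_{c+1} + q_{c+2}m_{c+2}
= fmean` by `r_c m_{c+1} = q_c m_c`; open pairs `≥ fmean` by legality; FLOORS: `Q_c` at `v = x` (openness only increases), open sets at `v = min x₁`
under the single floor condition `x·(m₀+m₁+m₂) ≤ fmean·x₁ᵢ` (i = 0,1,2), automatic for a common opened floor (`…_of_common_x₁`).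

CENSUS (exact rationals, census-1 g27 `code/gcyclic.py`, `code/reach27.py`; arm-1 g53's uniform ensemble rationalised as in g26: `qᵢ ∈ {.02,…,.98}`,
`mᵢ ∈ [1,6]`, `x₁ᵢ ∈ [.3,1]`): identity exact on 3000/3000 random `(q,m)`; legal ⟹ all seven weights `≥ 0` (498/498); and CYCLIC LEGALITY IN SOME
ORIENTATION (+ the floor condition) COINCIDES WITH FEASIBILITY OF THE WHOLE BOOSTED-DICTIONARY LP (all six `Q_{d,j}` + all open sets) on 1500/1500
groups (21.5 %; symmetric difference 0) — so this file is the exact reach of boosting at width 3; heavy-balanced (✓ p496166) 30.5 %, union 40.5 %; with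
the grid-8 LP of the criterion 45.0 %, total union 52.8 % (400 groups).

* **`sdec_flaw_cyclicTripleGen_of_oracle`**: `0 < x < 1`; `s₀ s₁ s₂` tree-built at `x`; cyclic legality `s₁.q·s₁.mean + s₀.q·s₀.mean ≤ s₁.mean`,
  `s₂.q·s₂.mean + s₁.q·s₁.mean ≤ s₂.mean`, `s₀.q·s₀.mean + s₂.q·s₂.mean ≤ s₀.mean`; floor condition `x·(Σ mean) ≤ fmean·sᵢ.x₁`; the oracle below
  `fgates [s₀,s₁,s₂]` ⟹ `SDEC x (ftop [s₀,s₁,s₂]) (flaw [s₀,s₁,s₂])`.  (The other orientation is the same theorem applied to `[s₀,s₂,s₁]`.)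
* **`sdec_flaw_cyclicTripleGen_of_common_x₁`**: the same with a common opened floor instead of the floor condition.

HONEST STATUS.  A width-3 sub-family of the open core; `SiblingStep` ⟺ `GateStepN`, `UPartStep`, `LightResidDECOracle`, `FarTreeRow` remain OPEN; RATE class
(log\*) and the honest sentence of `run/shared/lean/prim/quant/README.md` unchanged.  [this work]; nothing here is cited as a published result.  The gluing
rows served [cite: KozmaNitzan2024, Conjecture 3 (p. 15)]; product measure [cite: Grimmett1999, §1.3 p. 10].
-/

noncomputable section

open scoped BigOperators

namespace Summit.CriticalPhenomena.PercolationContinuityZ3.Theorems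
namespace Quant
namespace LawDec

open Finset

/-- **the pattern identity of the GENERAL cyclic boost certificate** (numerators; `Δ` cleared): for gates `a, b, c` of siblings `0, 1, 2`, boost
ratios `r₀, r₁, r₂` (ARBITRARY reals) and every non-empty `A ⊆ {0,1,2}`, `Σ_k N_k·P_k(A) = Δ·Π_{i∈A} qᵢ Π_{i∉A} (1−qᵢ)` with the seven components of the
module docstring. [this work] -/
theorem cyclicTripleGen_pattern (a b c r₀ r₁ r₂ : ℝ) (A : Finset (Fin 3)) (hA : A.Nonempty) :
    let Δ : ℝ := a * (1 - c - r₁) * (b * (1 - a - r₂)) * (c * (1 - b - r₀))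
      + (a + r₂) * (1 - b) * ((b + r₀) * (1 - c)) * ((c + r₁) * (1 - a))
    ∑ k : Fin 7,
      (![b * (1 - a) * (1 - b) * (a * r₁ * r₂ + a * c * (1 - a) * (1 - c - r₁) + r₂ * (c + r₁) * (1 - c) * (1 - a)),
          c * (1 - b) * (1 - c) * (b * r₂ * r₀ + b * a * (1 - b) * (1 - a - r₂) + r₀ * (a + r₂) * (1 - a) * (1 - b)),
          a * (1 - c) * (1 - a) * (c * r₀ * r₁ + c * b * (1 - c) * (1 - b - r₀) + r₁ * (b + r₀) * (1 - b) * (1 - c)),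
          c * b * (1 - a) * a * (1 - a - r₂) * (b * c * (1 - c - r₁) * (1 - b - r₀) + r₁ * (b + r₀) * (1 - b)),
          a * c * (1 - b) * b * (1 - b - r₀) * (c * a * (1 - a - r₂) * (1 - c - r₁) + r₂ * (c + r₁) * (1 - c)),
          b * a * (1 - c) * c * (1 - c - r₁) * (a * b * (1 - b - r₀) * (1 - a - r₂) + r₀ * (a + r₂) * (1 - a)),
          a * b * c * Δ] : Fin 7 → ℝ) k *
        (if A ⊆ (![{1, 2}, {2, 0}, {0, 1}, {1, 2}, {2, 0}, {0, 1}, {0, 1, 2}] : Fin 7 → Finset (Fin 3)) k then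
          (∏ i ∈ A, (![fun l => if l = (1 : Fin 3) then b + r₀ else c, fun l => if l = (2 : Fin 3) then c + r₁ else a,
              fun l => if l = (0 : Fin 3) then a + r₂ else b, fun _ => 1, fun _ => 1, fun _ => 1, fun _ => 1] : Fin 7 → Fin 3 → ℝ) k i) *
            ∏ i ∈ (![{1, 2}, {2, 0}, {0, 1}, {1, 2}, {2, 0}, {0, 1}, {0, 1, 2}] : Fin 7 → Finset (Fin 3)) k \ A,
              (1 - (![fun l => if l = (1 : Fin 3) then b + r₀ else c, fun l => if l = (2 : Fin 3) then c + r₁ else a,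
                fun l => if l = (0 : Fin 3) then a + r₂ else b, fun _ => 1, fun _ => 1, fun _ => 1, fun _ => 1] : Fin 7 → Fin 3 → ℝ) k i)
        else 0)
      = Δ * ((∏ i ∈ A, (![a, b, c] : Fin 3 → ℝ) i) * ∏ i ∈ (Finset.univ : Finset (Fin 3)) \ A, (1 - (![a, b, c] : Fin 3 → ℝ) i)) := by
  intro Δ
  have hA' : A ≠ ∅ := Finset.nonempty_iff_ne_empty.1 hA
  have key : ∀ B : Finset (Fin 3), B ≠ ∅ →
      B = {0} ∨ B = {1} ∨ B = {2} ∨ B = {0, 1} ∨ B = {0, 2} ∨ B = {1, 2} ∨ B = {0, 1, 2} := by decide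
  have huniv : (Finset.univ : Finset (Fin 3)) = {0, 1, 2} := by decide
  rw [huniv]
  rcases key A hA' with rfl | rfl | rfl | rfl | rfl | rfl | rfl <;>
    simp (config := {decide := true}) [Fin.sum_univ_succ, Finset.sdiff_eq_filter, Finset.filter_insert,
      Finset.filter_singleton, Finset.prod_insert, Finset.prod_singleton, Δ] <;> ring

set_option maxHeartbeats 400000 in
/-- **THE GENERAL CYCLIC BOOST TRIPLE (SDEC form, given the oracle).**  Three tree-built siblings at floor `x` (arbitrary gates, opened means,
sub-trees), CYCLICALLY LEGAL root gates `q_{c+1} m_{c+1} + q_c m_c ≤ m_{c+1}` (c mod 3), the floor condition `x·(m₀+m₁+m₂) ≤ fmean·x₁ᵢ`, and the oracle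
below `fgates [s₀,s₁,s₂]` ⟹ the forest is SDEC at `x` — by the sub-product mixture criterion with the seven-component general cyclic certificate
(`cyclicTripleGen_pattern` at `r_c = q_c m_c / m_{c+1}`). [this work] -/
theorem sdec_flaw_cyclicTripleGen_of_oracle {x : ℝ} (hx0 : 0 < x) (hx1 : x < 1) (s₀ s₁ s₂ : Sib)
    (h₀ : s₀.TreeOK x) (h₁ : s₁.TreeOK x) (h₂ : s₂.TreeOK x)
    (h01 : s₁.q * s₁.mean + s₀.q * s₀.mean ≤ s₁.mean) (h12 : s₂.q * s₂.mean + s₁.q * s₁.mean ≤ s₂.mean)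
    (h20 : s₀.q * s₀.mean + s₂.q * s₂.mean ≤ s₀.mean)
    (hf₀ : x * (s₀.mean + s₁.mean + s₂.mean) ≤ fmean [s₀, s₁, s₂] * s₀.x₁)
    (hf₁ : x * (s₀.mean + s₁.mean + s₂.mean) ≤ fmean [s₀, s₁, s₂] * s₁.x₁)
    (hf₂ : x * (s₀.mean + s₁.mean + s₂.mean) ≤ fmean [s₀, s₁, s₂] * s₂.x₁)
    (hO : ∀ (x' : ℝ) (n' M' : ℕ) (μ' : ℕ → ℝ), n' < fgates [s₀, s₁, s₂] → TreeBuiltN x' n' M' μ' → SDEC x' M' μ') :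
    SDEC x (ftop [s₀, s₁, s₂]) (flaw [s₀, s₁, s₂]) := by
  classical
  have hm0 : 0 < s₀.mean := s₀.mean_pos h₀
  have hm1 : 0 < s₁.mean := s₁.mean_pos h₁
  have hm2 : 0 < s₂.mean := s₂.mean_pos h₂
  have hL : ∀ t ∈ [s₀, s₁, s₂], t.TreeOK x := by
    intro t ht
    simp only [List.mem_cons, List.not_mem_nil, or_false] at ht
    rcases ht with rfl | rfl | rfl
    · exact h₀
    · exact h₁
    · exact h₂
  obtain ⟨ha0, ha1, hxa, hT₀, _⟩ := h₀
  obtain ⟨hb0, hb1, hxb, hT₁, _⟩ := h₁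
  obtain ⟨hc0, hc1, hxc, hT₂, _⟩ := h₂
  obtain ⟨hy00, hy01, _, _, _, _⟩ := hT₀.lawFacts
  obtain ⟨hy10, hy11, _, _, _, _⟩ := hT₁.lawFacts
  obtain ⟨hy20, hy21, _, _, _, _⟩ := hT₂.lawFacts
  set a : ℝ := s₀.q with hadef
  set b : ℝ := s₁.q with hbdef
  set c : ℝ := s₂.q with hcdef
  set m₀ : ℝ := s₀.mean with hm₀def
  set m₁ : ℝ := s₁.mean with hm₁def
  set m₂ : ℝ := s₂.mean with hm₂def
  set y₀ : ℝ := s₀.x₁ with hy₀def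
  set y₁ : ℝ := s₁.x₁ with hy₁def
  set y₂ : ℝ := s₂.x₁ with hy₂def
  -- the boost ratios
  set r₀ : ℝ := a * m₀ / m₁ with hr₀def
  set r₁ : ℝ := b * m₁ / m₂ with hr₁def
  set r₂ : ℝ := c * m₂ / m₀ with hr₂def
  have hr₀ : r₀ * m₁ = a * m₀ := div_mul_cancel₀ _ hm1.ne'
  have hr₁ : r₁ * m₂ = b * m₁ := div_mul_cancel₀ _ hm2.ne'
  have hr₂ : r₂ * m₀ = c * m₂ := div_mul_cancel₀ _ hm0.ne'
  have hr₀0 : 0 < r₀ := div_pos (mul_pos ha0 hm0) hm1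
  have hr₁0 : 0 < r₁ := div_pos (mul_pos hb0 hm1) hm2
  have hr₂0 : 0 < r₂ := div_pos (mul_pos hc0 hm2) hm0
  -- cyclic legality in ratio form
  have hl0 : b + r₀ ≤ 1 := by
    have h : (b + r₀) * m₁ ≤ 1 * m₁ := by rw [add_mul, hr₀, one_mul]; exact h01
    exact le_of_mul_le_mul_right h hm1
  have hl1 : c + r₁ ≤ 1 := by
    have h : (c + r₁) * m₂ ≤ 1 * m₂ := by rw [add_mul, hr₁, one_mul]; exact h12
    exact le_of_mul_le_mul_right h hm2
  have hl2 : a + r₂ ≤ 1 := by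
    have h : (a + r₂) * m₀ ≤ 1 * m₀ := by rw [add_mul, hr₂, one_mul]; exact h20
    exact le_of_mul_le_mul_right h hm0
  have hmean : ∀ i : Fin [s₀, s₁, s₂].length, ([s₀, s₁, s₂].get i).mean = (![m₀, m₁, m₂] : Fin 3 → ℝ) i := by
    intro i; fin_cases i <;> rfl
  have hfloor : ∀ i : Fin [s₀, s₁, s₂].length, ([s₀, s₁, s₂].get i).x₁ = (![y₀, y₁, y₂] : Fin 3 → ℝ) i := by
    intro i; fin_cases i <;> rfl
  have hgate : ∀ i : Fin [s₀, s₁, s₂].length, ([s₀, s₁, s₂].get i).q = (![a, b, c] : Fin 3 → ℝ) i := by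
    intro i; fin_cases i <;> rfl
  set fm : ℝ := a * m₀ + b * m₁ + c * m₂ with hfmdef
  have hfm : fmean [s₀, s₁, s₂] = fm := by
    simp only [fmean, hfmdef]; ring
  have hfm0 : 0 < fm := by positivity
  rw [hfm] at hf₀ hf₁ hf₂
  -- the determinant
  set Δ : ℝ := a * (1 - c - r₁) * (b * (1 - a - r₂)) * (c * (1 - b - r₀))
      + (a + r₂) * (1 - b) * ((b + r₀) * (1 - c)) * ((c + r₁) * (1 - a)) with hΔ
  have e0 : (0:ℝ) ≤ 1 - b - r₀ := by linarith
  have e1 : (0:ℝ) ≤ 1 - c - r₁ := by linarith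
  have e2 : (0:ℝ) ≤ 1 - a - r₂ := by linarith
  have f1 : (0:ℝ) < 1 - a := by linarith
  have f2 : (0:ℝ) < 1 - b := by linarith
  have f3 : (0:ℝ) < 1 - c := by linarith
  have hΔ0 : 0 < Δ := by
    have h1 : 0 ≤ a * (1 - c - r₁) * (b * (1 - a - r₂)) * (c * (1 - b - r₀)) :=
      mul_nonneg (mul_nonneg (mul_nonneg ha0.le e1) (mul_nonneg hb0.le e2)) (mul_nonneg hc0.le e0)
    have h2 : 0 < (a + r₂) * (1 - b) * ((b + r₀) * (1 - c)) * ((c + r₁) * (1 - a)) := by positivity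
    linarith
  -- the certificate data
  set N : Fin 7 → ℝ :=
    ![b * (1 - a) * (1 - b) * (a * r₁ * r₂ + a * c * (1 - a) * (1 - c - r₁) + r₂ * (c + r₁) * (1 - c) * (1 - a)),
      c * (1 - b) * (1 - c) * (b * r₂ * r₀ + b * a * (1 - b) * (1 - a - r₂) + r₀ * (a + r₂) * (1 - a) * (1 - b)),
      a * (1 - c) * (1 - a) * (c * r₀ * r₁ + c * b * (1 - c) * (1 - b - r₀) + r₁ * (b + r₀) * (1 - b) * (1 - c)),
      c * b * (1 - a) * a * (1 - a - r₂) * (b * c * (1 - c - r₁) * (1 - b - r₀) + r₁ * (b + r₀) * (1 - b)),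
      a * c * (1 - b) * b * (1 - b - r₀) * (c * a * (1 - a - r₂) * (1 - c - r₁) + r₂ * (c + r₁) * (1 - c)),
      b * a * (1 - c) * c * (1 - c - r₁) * (a * b * (1 - b - r₀) * (1 - a - r₂) + r₀ * (a + r₂) * (1 - a)),
      a * b * c * Δ] with hN
  set u : Fin 7 → ℝ := fun k => N k / Δ with hu
  set E : Fin 7 → Finset (Fin 3) := ![{1, 2}, {2, 0}, {0, 1}, {1, 2}, {2, 0}, {0, 1}, {0, 1, 2}] with hE
  set o : Fin 7 → Fin 3 → ℝ :=
    ![fun l => if l = (1 : Fin 3) then b + r₀ else c, fun l => if l = (2 : Fin 3) then c + r₁ else a,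
      fun l => if l = (0 : Fin 3) then a + r₂ else b, fun _ => 1, fun _ => 1, fun _ => 1, fun _ => 1] with ho
  set v : Fin 7 → ℝ := ![x, x, x, min y₁ y₂, min y₂ y₀, min y₀ y₁, min y₀ (min y₁ y₂)] with hv
  -- nonnegativity of the numerators: sums of products of nonnegative reals
  have n0 : 0 ≤ b * (1 - a) * (1 - b) * (a * r₁ * r₂ + a * c * (1 - a) * (1 - c - r₁) + r₂ * (c + r₁) * (1 - c) * (1 - a)) :=
    mul_nonneg (by positivity) (add_nonneg (add_nonneg (by positivity) (mul_nonneg (by positivity) e1)) (by positivity))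
  have n1 : 0 ≤ c * (1 - b) * (1 - c) * (b * r₂ * r₀ + b * a * (1 - b) * (1 - a - r₂) + r₀ * (a + r₂) * (1 - a) * (1 - b)) :=
    mul_nonneg (by positivity) (add_nonneg (add_nonneg (by positivity) (mul_nonneg (by positivity) e2)) (by positivity))
  have n2 : 0 ≤ a * (1 - c) * (1 - a) * (c * r₀ * r₁ + c * b * (1 - c) * (1 - b - r₀) + r₁ * (b + r₀) * (1 - b) * (1 - c)) :=
    mul_nonneg (by positivity) (add_nonneg (add_nonneg (by positivity) (mul_nonneg (by positivity) e0)) (by positivity))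
  have n3 : 0 ≤ c * b * (1 - a) * a * (1 - a - r₂) * (b * c * (1 - c - r₁) * (1 - b - r₀) + r₁ * (b + r₀) * (1 - b)) :=
    mul_nonneg (mul_nonneg (by positivity) e2) (add_nonneg (mul_nonneg (mul_nonneg (by positivity) e1) e0) (by positivity))
  have n4 : 0 ≤ a * c * (1 - b) * b * (1 - b - r₀) * (c * a * (1 - a - r₂) * (1 - c - r₁) + r₂ * (c + r₁) * (1 - c)) :=
    mul_nonneg (mul_nonneg (by positivity) e0) (add_nonneg (mul_nonneg (mul_nonneg (by positivity) e2) e1) (by positivity))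
  have n5 : 0 ≤ b * a * (1 - c) * c * (1 - c - r₁) * (a * b * (1 - b - r₀) * (1 - a - r₂) + r₀ * (a + r₂) * (1 - a)) :=
    mul_nonneg (mul_nonneg (by positivity) e1) (add_nonneg (mul_nonneg (mul_nonneg (by positivity) e0) e2) (by positivity))
  have n6 : 0 ≤ a * b * c * Δ := mul_nonneg (by positivity) hΔ0.le
  have hN0 : ∀ k, 0 ≤ N k := by
    intro k
    fin_cases k
    exacts [n0, n1, n2, n3, n4, n5, n6]
  clear n0 n1 n2 n3 n4 n5 n6
  -- gated means of the components
  have hmc : ∀ k, fmean (subRegate [s₀, s₁, s₂] (E k) (o k)) = (![fm, fm, fm, m₁ + m₂, m₂ + m₀, m₀ + m₁, m₀ + m₁ + m₂] : Fin 7 → ℝ) k := by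
    intro k
    rw [fmean_subRegate, Finset.sum_congr rfl fun i _ => by rw [hmean i]]
    fin_cases k <;> simp [hE, ho, Finset.sum_insert, hfmdef] <;> linarith [hr₀, hr₁, hr₂]
  refine sdec_flaw_of_subproductMix hx0 hx1 [s₀, s₁, s₂] hL (by simp) hO (Finset.univ : Finset (Fin 7)) u E o
    ?_ ?_ ?_ ?_ ?_ v ?_ ?_ ?_ ?_
  · intro k _; exact div_nonneg (hN0 k) hΔ0.le
  · intro k _ i hi
    fin_cases k <;> simp [hE] at hi <;> rcases hi with rfl | rfl | rfl <;> simp [ho] <;>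
      linarith only [ha0, hb0, hc0, hr₀0, hr₁0, hr₂0]
  · intro k _ i hi
    fin_cases k <;> simp [hE] at hi <;> rcases hi with rfl | rfl | rfl <;> simp [ho] <;>
      linarith only [hl0, hl1, hl2, ha1, hb1, hc1]
  · intro k _
    fin_cases k
    · exact ⟨0, Or.inl (show (0 : Fin 3) ∉ ({1, 2} : Finset (Fin 3)) by decide)⟩
    · exact ⟨1, Or.inl (show (1 : Fin 3) ∉ ({2, 0} : Finset (Fin 3)) by decide)⟩
    · exact ⟨2, Or.inl (show (2 : Fin 3) ∉ ({0, 1} : Finset (Fin 3)) by decide)⟩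
    · exact ⟨0, Or.inl (show (0 : Fin 3) ∉ ({1, 2} : Finset (Fin 3)) by decide)⟩
    · exact ⟨1, Or.inl (show (1 : Fin 3) ∉ ({2, 0} : Finset (Fin 3)) by decide)⟩
    · exact ⟨2, Or.inl (show (2 : Fin 3) ∉ ({0, 1} : Finset (Fin 3)) by decide)⟩
    · exact ⟨0, Or.inr rfl⟩
  · -- the pattern identity
    intro A hA
    have e : ((∏ i ∈ A, ([s₀, s₁, s₂].get i).q) * ∏ i ∈ Finset.univ \ A, (1 - ([s₀, s₁, s₂].get i).q))
          = (∏ i ∈ A, (![a, b, c] : Fin 3 → ℝ) i) * ∏ i ∈ Finset.univ \ A, (1 - (![a, b, c] : Fin 3 → ℝ) i) := by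
      simp only [hgate]
    rw [e]
    simp only [hu, div_mul_eq_mul_div, ← Finset.sum_div]
    rw [div_eq_iff hΔ0.ne']
    have hp := cyclicTripleGen_pattern a b c r₀ r₁ r₂ A hA
    simp only at hp
    rw [hN, hE, ho, hΔ]
    exact hp.trans (mul_comm _ _)
  · intro k _
    have v3 : 0 < min y₁ y₂ := lt_min hy10 hy20
    have v4 : 0 < min y₂ y₀ := lt_min hy20 hy00
    have v5 : 0 < min y₀ y₁ := lt_min hy00 hy10
    have v6 : 0 < min y₀ (min y₁ y₂) := lt_min hy00 (lt_min hy10 hy20)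
    fin_cases k <;> simp only [hv] <;> first | exact hx0 | exact v3 | exact v4 | exact v5 | exact v6
  · intro k _ i hi
    have g0 : x ≤ (b + r₀) * y₁ := hxb.trans (by nlinarith only [hr₀0, hy10])
    have g1 : x ≤ (c + r₁) * y₂ := hxc.trans (by nlinarith only [hr₁0, hy20])
    have g2 : x ≤ (a + r₂) * y₀ := hxa.trans (by nlinarith only [hr₂0, hy00])
    have k12a : min y₁ y₂ ≤ y₁ := min_le_left _ _
    have k12b : min y₁ y₂ ≤ y₂ := min_le_right _ _
    have k20a : min y₂ y₀ ≤ y₂ := min_le_left _ _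
    have k20b : min y₂ y₀ ≤ y₀ := min_le_right _ _
    have k01a : min y₀ y₁ ≤ y₀ := min_le_left _ _
    have k01b : min y₀ y₁ ≤ y₁ := min_le_right _ _
    have kA0 : min y₀ (min y₁ y₂) ≤ y₀ := min_le_left _ _
    have kA1 : min y₀ (min y₁ y₂) ≤ y₁ := (min_le_right _ _).trans (min_le_left _ _)
    have kA2 : min y₀ (min y₁ y₂) ≤ y₂ := (min_le_right _ _).trans (min_le_right _ _)
    fin_cases k <;> simp [hE] at hi <;> rcases hi with rfl | rfl | rfl <;> simp [hv, ho] <;>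
      first
        | exact hxa
        | exact hxb
        | exact hxc
        | exact g0
        | exact g1
        | exact g2
        | exact k12a
        | exact k12b
        | exact k20a
        | exact k20b
        | exact k01a
        | exact k01b
        | exact kA0
        | exact kA1
        | exact kA2
        | exact Or.inl le_rfl
        | exact Or.inr le_rfl
        | exact Or.inr (Or.inl le_rfl)
        | exact Or.inr (Or.inr le_rfl)
  · intro k _
    rw [hmc, hfm]
    have hq0 : x * fm ≤ fm * x := le_of_eq (mul_comm _ _)
    have t0 : x * (m₁ + m₂) ≤ x * (m₀ + m₁ + m₂) := by nlinarith only [hx0, hm0]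
    have t1 : x * (m₂ + m₀) ≤ x * (m₀ + m₁ + m₂) := by nlinarith only [hx0, hm1]
    have t2 : x * (m₀ + m₁) ≤ x * (m₀ + m₁ + m₂) := by nlinarith only [hx0, hm2]
    have hq3 : x * (m₁ + m₂) ≤ fm * min y₁ y₂ := by
      rw [mul_min_of_nonneg _ _ hfm0.le]; exact le_min (t0.trans hf₁) (t0.trans hf₂)
    have hq4 : x * (m₂ + m₀) ≤ fm * min y₂ y₀ := by
      rw [mul_min_of_nonneg _ _ hfm0.le]; exact le_min (t1.trans hf₂) (t1.trans hf₀)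
    have hq5 : x * (m₀ + m₁) ≤ fm * min y₀ y₁ := by
      rw [mul_min_of_nonneg _ _ hfm0.le]; exact le_min (t2.trans hf₀) (t2.trans hf₁)
    have hq6 : x * (m₀ + m₁ + m₂) ≤ fm * min y₀ (min y₁ y₂) := by
      rw [mul_min_of_nonneg _ _ hfm0.le, mul_min_of_nonneg _ _ hfm0.le]
      exact le_min hf₀ (le_min hf₁ hf₂)
    fin_cases k <;> simp only [hv] <;> first | exact hq0 | exact hq3 | exact hq4 | exact hq5 | exact hq6
  · intro k _
    rw [hmc, hfm]
    have ca : a * m₀ ≤ m₀ := by nlinarith only [ha1, hm0]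
    have cb : b * m₁ ≤ m₁ := by nlinarith only [hb1, hm1]
    have cc : c * m₂ ≤ m₂ := by nlinarith only [hc1, hm2]
    have p3 : fm ≤ m₁ + m₂ := by rw [hfmdef]; linarith only [h01, cc]
    have p4 : fm ≤ m₂ + m₀ := by rw [hfmdef]; linarith only [h12, ca]
    have p5 : fm ≤ m₀ + m₁ := by rw [hfmdef]; linarith only [h20, cb]
    have p6 : fm ≤ m₀ + m₁ + m₂ := by rw [hfmdef]; linarith only [ca, cb, cc]
    fin_cases k <;> simp <;> first | exact p3 | exact p4 | exact p5 | exact p6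

/-- **THE GENERAL CYCLIC BOOST TRIPLE with a common opened floor**: as `sdec_flaw_cyclicTripleGen_of_oracle`, the floor condition being automatic
when `s₁.x₁ = s₀.x₁ = s₂.x₁` (`x·mᵢ ≤ qᵢ mᵢ x₁` summed).  With equal opened means this is census-1 g26's `sdec_flaw_cyclicTriple_of_oracle`. [this work] -/
theorem sdec_flaw_cyclicTripleGen_of_common_x₁ {x : ℝ} (hx0 : 0 < x) (hx1 : x < 1) (s₀ s₁ s₂ : Sib)
    (h₀ : s₀.TreeOK x) (h₁ : s₁.TreeOK x) (h₂ : s₂.TreeOK x) (hy₁ : s₁.x₁ = s₀.x₁) (hy₂ : s₂.x₁ = s₀.x₁)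
    (h01 : s₁.q * s₁.mean + s₀.q * s₀.mean ≤ s₁.mean) (h12 : s₂.q * s₂.mean + s₁.q * s₁.mean ≤ s₂.mean)
    (h20 : s₀.q * s₀.mean + s₂.q * s₂.mean ≤ s₀.mean)
    (hO : ∀ (x' : ℝ) (n' M' : ℕ) (μ' : ℕ → ℝ), n' < fgates [s₀, s₁, s₂] → TreeBuiltN x' n' M' μ' → SDEC x' M' μ') :
    SDEC x (ftop [s₀, s₁, s₂]) (flaw [s₀, s₁, s₂]) := by
  have hm0 : 0 < s₀.mean := s₀.mean_pos h₀
  have hm1 : 0 < s₁.mean := s₁.mean_pos h₁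
  have hm2 : 0 < s₂.mean := s₂.mean_pos h₂
  have hxa : x ≤ s₀.q * s₀.x₁ := h₀.2.2.1
  have hxb : x ≤ s₁.q * s₀.x₁ := by rw [← hy₁]; exact h₁.2.2.1
  have hxc : x ≤ s₂.q * s₀.x₁ := by rw [← hy₂]; exact h₂.2.2.1
  have hfm : fmean [s₀, s₁, s₂] = s₀.q * s₀.mean + s₁.q * s₁.mean + s₂.q * s₂.mean := by
    simp only [fmean]; ring
  have hf : x * (s₀.mean + s₁.mean + s₂.mean) ≤ fmean [s₀, s₁, s₂] * s₀.x₁ := by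
    rw [hfm]; nlinarith only [hxa, hxb, hxc, hm0, hm1, hm2]
  exact sdec_flaw_cyclicTripleGen_of_oracle hx0 hx1 s₀ s₁ s₂ h₀ h₁ h₂ h01 h12 h20 hf (by rw [hy₁]; exact hf) (by rw [hy₂]; exact hf) hO

end LawDec
end Quant
end Summit.CriticalPhenomena.PercolationContinuityZ3.Theorems
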